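import Summits.QuantumFields.BalabanUV.Beta.FP.ConstrainedBiLaplacianResponse
import Summits.QuantumFields.BalabanUV.Beta.GAN24.SubAveragingKernel

/-!
# `BalabanUV.Beta.FP.ConstrainedBiLaplacianResponseTwoLevel` — road «FP» for binder row D1, DESIGN ROW **GHOST-STEP** brick (g3) «(CONV-C)-Hb»,
# THE CONVERGENCE HALF, FILE 6a — THE EXACT COARSE-ALIAS FORM OF THE SUB-CELL-SUMMED FINER RESPONSE: `Σ_ρ hM (n·L) s (Tsub τ ρ) =
# n^{−d}·Σ_k F n τ k · betaT n L s k` with `betaT` expressed through the lineage's once-sub-averaged weights `W1(Kof k m)` and the order-`s`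
# transferred inverse symbols `T2_k = Σ_m W1(Kof k m)·ainv (n·L) s (Kof k m)` — pure algebra over `SubAveragingKernel.sum_F_Tsub` and `sum_Kof_eq`

NOT IN PRINT; OUR PROOF ATTEMPT (binder row G-an2-4 ∕ (CONV-C), prover part P3 = fibre∕strip «Woodbury» lineage, gen 28; CRUX TEAM (2),
2026-08-21).  HONEST DEPENDENCY (cell records, verbatim): «continuum YM on T⁴ ⇐ BetaPertH ∧ nine spine estimates (0/9 proved); BetaPertH ⇐ (D1) ∧
(D4) ∧ CAP+tail; G-an2-4 gates asym, D1 and NE2/3/4.»  HONEST FRAMING (cell contract, verbatim): «discharging `BetaPertH` makes Bałaban's UV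
stability UNCONDITIONAL — a real constructive-QFT result; it is NOT the continuum limit and NOT the Clay problem.»  ABSOLUTE RULE (cell charter,
verbatim): «No internally-minted statement may enter as a cited fact. Every hypothesis is either kernel-proved in this package or a verbatim quotation
of a PUBLISHED theorem with page reference. The manuscript(s) under audit are NOT citable for their own disputed steps — they are the thing under
adjudication; programme-internal (2001/route/tribunal) claims are never citable.»  THIS MODULE is [folklore] algebra over FILE 3 of this programme
(`bvec`, `hM`) and the lineage's gen-22 «SUBAVG-RATE» files (`SubAveragingKernel.Tsub`∕`sum_F_Tsub`, `SubAveragingCoreEstimate.W1`,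
`SubAveragingCore.Kof`, `SubAveragingFibreColumn.sum_Kof_eq`∕`U_mul_Kof`, `SubAveragingFibre.Kof_zero`); it cites nothing as a hypothesis, has FOUR
bookkeeping `def`s (`beta`, `T2`, `T2far`, `betaT`), no `def … : Prop`, no `sorry`.

## The mechanism (Q-FP-13-2 (ii), located in the INTENT «SB-CELL», journal 2026-08-21)

The one-step law of the block-sum response compares the level-`n·L` response SUMMED over the `L^d` finer offsets of a level-`n` cell `τ`
with the level-`n` response at `τ` (both answer a unit block sum prescribed at a block).  Writing FILE 3's components as `bvec_K = beta_K·u_K`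
(`beta_0 = 1∕den`, `beta_K = (Δ^ξ)^s a_K∕den`; §1) and `EF(τ,K)·u_K = F N τ K` ([B4]'s full numerator), the response multiplier is
`hM N s τ = N^{−d}Σ_K F N τ K·beta_K` (§1), and the lineage's EXACT sub-cell identity `Σ_ρ F (n·L) (Tsub τ ρ) (Kof k m) = L^d·F n τ k·W1(Kof k m)`
(the cell-average phase and the `Q′`-leg phase recombine to the COARSE numerator — no first-order-in-`1∕N` phase survives) gives
**`sum_hM_Tsub`**: `Σ_ρ hM (n·L) s (Tsub τ ρ) = n^{−d}Σ_k F n τ k·betaT n L s k`, `betaT_k = Σ_m W1(Kof k m)·beta_{n·L}(Kof k m)` (§2), with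
**`betaT_of_ne`** (`k ≠ 0`: `= (Δ^{ξ∕L})^s∕den_{nL}·T2_k`), **`betaT_zero`** (`= (W1(0) + (Δ^{ξ∕L})^s·T2far)∕den_{nL}`), hence
**`sum_hM_Tsub_sub_hM`**: `Σ_ρ hM (n·L) s (Tsub τ ρ) − hM n s τ = n^{−d}Σ_k F n τ k·(betaT_k − beta_k)` and the regrouped finer denominator
**`den_mul_eq`**: `den (n·L) s = U_0·W1(0) + (Δ^{ξ∕L})^s·(Σ_{k≠0} U_k·T2_k + U_0·T2far)` on the fat region.  FILE 6b estimates `betaT_k − beta_k`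
(`= O(n^{−2})` uniformly in `k`, the lineage's `SubAveragingCoreEstimate` at order `s = 2`), FILE 6c turns it into the kernel rate.

0∕4 row-D1 binders touched.  NOT (CONV-C), NEVER «G-an2-4 closed», NOT the ghost step law, NOT SDF, NOT D1, NOT BetaPertH, NOT continuum, NOT Clay.
Provenance: prover-b2b-balaban-gan24-p3-g28-0 (unit `b2b-balaban-gan24-p3`, gen 28), 2026-08-21; no existing file touched.
-/

noncomputable section

namespace Summit.QuantumFields.BalabanUV.Beta.FP.ConstrainedBiLaplacianResponseTwoLevel

open Complex Finset ComplexConjugate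
open Literature.MathematicalPhysics.QuantumFieldTheory.Balaban1983to89
open Literature.MathematicalPhysics.QuantumFieldTheory.Balaban1983to89.B4Strip
open Literature.MathematicalPhysics.QuantumFieldTheory.Balaban1983to89.B4StripCauchy
open Literature.MathematicalPhysics.QuantumFieldTheory.Balaban1983to89.B5Strip145Analytic
open Literature.MathematicalPhysics.QuantumFieldTheory.Balaban1983to89.B4StripSums
open Summit.QuantumFields.BalabanUV.Beta.FP.ConstrainedBiLaplacianStrip
open Summit.QuantumFields.BalabanUV.Beta.FP.ConstrainedBiLaplacianFibre
open Summit.QuantumFields.BalabanUV.Beta.FP.ConstrainedBiLaplacianFibreEntries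
open Summit.QuantumFields.BalabanUV.Beta.FP.ConstrainedBiLaplacianFibreSides
open Summit.QuantumFields.BalabanUV.Beta.FP.ConstrainedBiLaplacianKernel
open Summit.QuantumFields.BalabanUV.Beta.FP.ConstrainedBiLaplacianFibreIdentities
open Summit.QuantumFields.BalabanUV.Beta.FP.ConstrainedBiLaplacianResponse
open Summit.QuantumFields.BalabanUV.Beta.GAN24.SubAveragingDirichlet (sw)
open Summit.QuantumFields.BalabanUV.Beta.GAN24.SubAveragingCore (Kof Kof_val Kof_ne_zero Kof_apply_eq_zero_iff)
open Summit.QuantumFields.BalabanUV.Beta.GAN24.SubAveragingCoreEstimate (W1)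
open Summit.QuantumFields.BalabanUV.Beta.GAN24.SubAveragingFibre (Kof_zero)
open Summit.QuantumFields.BalabanUV.Beta.GAN24.SubAveragingFibreColumn (sum_Kof_eq U_mul_Kof)
open Summit.QuantumFields.BalabanUV.Beta.GAN24.SubAveragingKernel (Tsub sum_F_Tsub)
open scoped Real

variable {d : ℕ}

/-! ## §1 The `u`-free part of the response components -/

section Beta

variable (N : ℕ) [NeZero N] (s : ℕ) (p : Fin d → ℂ)

/-- [folklore] **THE `u`-FREE PART OF THE RESPONSE COMPONENTS**: `beta_0 = 1∕den`, `beta_K = (Δ^ξ)^s a_K∕den` (`K ≠ 0`), so that `bvec_K = beta_K·u_K`. -/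
def beta (K : Fin d → Fin N) : ℂ := (if K = fun _ => (0 : Fin N) then 1 else DeltaXi N 0 p ^ s) * side N s K p / den N s p

/-- [folklore] `beta_0 = 1∕den`. -/
theorem beta_zero : beta N s p (fun _ => 0) = 1 / den N s p := by
  unfold beta side; rw [if_pos rfl, if_pos rfl, one_mul]

/-- [folklore] `beta_K = (Δ^ξ)^s a_K∕den` for `K ≠ 0`. -/
theorem beta_of_ne {K : Fin d → Fin N} (hK : K ≠ fun _ => 0) : beta N s p K = DeltaXi N 0 p ^ s * ainv N s K p / den N s p := by
  unfold beta side; rw [if_neg hK, if_neg hK]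

/-- [folklore] `bvec_K = beta_K · u_K`. -/
theorem bvec_eq_beta_mul (K : Fin d → Fin N) : bvec N s p K = beta N s p K * F N (fun _ => 0) K p := by
  unfold bvec beta; ring

/-- [folklore] The full numerator of [B4]: `EF(τ,K)·u_K = F N τ K` (`u_K = F N 0 K`). -/
theorem EF_mul_F_zero (τ K : Fin d → Fin N) : EF N τ K p * F N (fun _ => 0) K p = F N τ K p := by
  unfold EF F
  rw [← Finset.prod_mul_distrib]
  refine Finset.prod_congr rfl fun ν _ => ?_
  have h1 : ef N (K ν : ℕ) ((fun _ => (0 : Fin N)) ν : ℕ) (p ν) = 1 := by unfold ef; simp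
  rw [h1, one_mul]

/-- [folklore] **THE RESPONSE MULTIPLIER THROUGH THE FULL NUMERATOR**: `hM N s τ p = N^{−d}·Σ_K F N τ K p·beta_K`. -/
theorem hM_eq_sum_F (τ : Fin d → Fin N) : hM N s τ p = ((N : ℂ) ^ d)⁻¹ * ∑ K : Fin d → Fin N, F N τ K p * beta N s p K := by
  unfold hM
  congr 1
  refine Finset.sum_congr rfl fun K _ => ?_
  rw [bvec_eq_beta_mul, ← EF_mul_F_zero N p τ K]
  ring

end Beta

/-! ## §2 The transferred symbols and the exact coarse-alias form of the sub-cell sum -/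

section Transfer

variable (n L : ℕ) [NeZero n] [NeZero L] (s : ℕ) (p : Fin d → ℂ)

/-- [folklore] **THE ORDER-`s` TRANSFERRED INVERSE SYMBOL** above the coarse alias `k`: `T2 n L s k = Σ_m W1(Kof k m)·ainv (n·L) s (Kof k m)`
(at `s = 1` the lineage's once-sub-averaged finer free propagator `SubAveragingCoreEstimate.T` at `m² = 0`). -/
def T2 (k : Fin d → Fin n) : ℂ := ∑ m : Fin d → Fin L, W1 n L (Kof n L k m) p * ainv (n * L) s (Kof n L k m) p

/-- [folklore] The FAR part above the zero alias: `T2far = Σ_{m ≠ 0} W1(Kof 0 m)·ainv (n·L) s (Kof 0 m)`. -/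
def T2far : ℂ := ∑ m ∈ Finset.univ.erase (fun _ => (0 : Fin L)), W1 n L (Kof n L (fun _ => 0) m) p * ainv (n * L) s (Kof n L (fun _ => 0) m) p

/-- [folklore] **THE TRANSFERRED `u`-FREE COMPONENTS**: `betaT n L s k = Σ_m W1(Kof k m)·beta_{n·L}(Kof k m)`. -/
def betaT (k : Fin d → Fin n) : ℂ := ∑ m : Fin d → Fin L, W1 n L (Kof n L k m) p * beta (n * L) s p (Kof n L k m)

/-- [folklore] `k ≠ 0`: every finer alias above `k` is nonzero, so `betaT_k = (Δ^{ξ∕L}(p))^s∕den_{nL}·T2_k`. -/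
theorem betaT_of_ne {k : Fin d → Fin n} (hk : k ≠ fun _ => 0) :
    betaT n L s p k = DeltaXi (n * L) 0 p ^ s / den (n * L) s p * T2 n L s p k := by
  unfold betaT T2
  rw [Finset.mul_sum]
  refine Finset.sum_congr rfl fun m _ => ?_
  rw [beta_of_ne (n * L) s p (Kof_ne_zero n L hk m)]
  ring

/-- [folklore] `Kof 0 m = 0` iff `m = 0`. -/
theorem Kof_zero_eq_zero_iff (m : Fin d → Fin L) : Kof n L (fun _ => (0 : Fin n)) m = (fun _ => (0 : Fin (n * L))) ↔ m = fun _ => 0 := by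
  constructor
  · intro h
    funext ν
    have hν := congrFun h ν
    have := (Kof_apply_eq_zero_iff n L (fun _ => (0 : Fin n)) m ν).mp (by rw [hν]; rfl)
    exact Fin.ext (by rw [this.2]; rfl)
  · intro h; subst h; exact Kof_zero n L

/-- [folklore] `k = 0`: `betaT_0 = (W1(Kof 0 0) + (Δ^{ξ∕L}(p))^s·T2far)∕den_{nL}`. -/
theorem betaT_zero :
    betaT n L s p (fun _ => 0) = (W1 n L (Kof n L (fun _ => 0) (fun _ => 0)) p + DeltaXi (n * L) 0 p ^ s * T2far n L s p) / den (n * L) s p := by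
  unfold betaT T2far
  rw [← Finset.add_sum_erase Finset.univ _ (Finset.mem_univ (fun _ => (0 : Fin L)))]
  have h0 : beta (n * L) s p (Kof n L (fun _ => (0 : Fin n)) (fun _ => (0 : Fin L))) = 1 / den (n * L) s p := by
    rw [(Kof_zero_eq_zero_iff n L (fun _ => 0)).mpr rfl, beta_zero]
  have h1 : ∀ m ∈ Finset.univ.erase (fun _ => (0 : Fin L)),
      W1 n L (Kof n L (fun _ => 0) m) p * beta (n * L) s p (Kof n L (fun _ => 0) m)
        = DeltaXi (n * L) 0 p ^ s / den (n * L) s p * (W1 n L (Kof n L (fun _ => 0) m) p * ainv (n * L) s (Kof n L (fun _ => 0) m) p) := by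
    intro m hm
    have hm0 : Kof n L (fun _ => (0 : Fin n)) m ≠ fun _ => 0 :=
      fun h => (Finset.ne_of_mem_erase hm) ((Kof_zero_eq_zero_iff n L m).mp h)
    rw [beta_of_ne (n * L) s p hm0]
    ring
  rw [h0, Finset.sum_congr rfl h1, ← Finset.mul_sum]
  field_simp

/-- [folklore] **THE EXACT COARSE-ALIAS FORM OF THE SUB-CELL SUM OF THE FINER RESPONSE**:
`Σ_ρ hM (n·L) s (Tsub τ ρ) p = n^{−d}·Σ_k F n τ k p·betaT n L s p k` (every `p`; `sum_F_Tsub` + `sum_Kof_eq`). -/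
theorem sum_hM_Tsub (τ : Fin d → Fin n) :
    ∑ ρ : Fin d → Fin L, hM (n * L) s (Tsub n L τ ρ) p = ((n : ℂ) ^ d)⁻¹ * ∑ k : Fin d → Fin n, F n τ k p * betaT n L s p k := by
  have hn : (n : ℂ) ≠ 0 := Nat.cast_ne_zero.mpr (NeZero.ne n)
  have hL : (L : ℂ) ≠ 0 := Nat.cast_ne_zero.mpr (NeZero.ne L)
  simp_rw [hM_eq_sum_F (n * L) s p]
  rw [← Finset.mul_sum, Finset.sum_comm]
  simp_rw [sum_Kof_eq n L]
  have h1 : ∀ k : Fin d → Fin n, ∑ m : Fin d → Fin L, ∑ ρ : Fin d → Fin L,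
      F (n * L) (Tsub n L τ ρ) (Kof n L k m) p * beta (n * L) s p (Kof n L k m)
        = (L : ℂ) ^ d * (F n τ k p * betaT n L s p k) := fun k => by
    unfold betaT
    rw [Finset.mul_sum, Finset.mul_sum]
    refine Finset.sum_congr rfl fun m _ => ?_
    rw [← Finset.sum_mul, sum_F_Tsub]
    ring
  rw [Finset.sum_congr rfl (fun k _ => h1 k), ← Finset.mul_sum]
  push_cast
  field_simp
  ring

/-- [folklore] **THE DIFFERENCE THROUGH THE COARSE ALIASES**: `Σ_ρ hM (n·L) s (Tsub τ ρ) p − hM n s τ p = n^{−d}·Σ_k F n τ k p·(betaT_k − beta_k)`. -/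
theorem sum_hM_Tsub_sub_hM (τ : Fin d → Fin n) :
    ∑ ρ : Fin d → Fin L, hM (n * L) s (Tsub n L τ ρ) p - hM n s τ p
      = ((n : ℂ) ^ d)⁻¹ * ∑ k : Fin d → Fin n, F n τ k p * (betaT n L s p k - beta n s p k) := by
  rw [sum_hM_Tsub, hM_eq_sum_F n s p, ← mul_sub, ← Finset.sum_sub_distrib]
  congr 1
  refine Finset.sum_congr rfl fun k _ => ?_
  ring

/-- [folklore] **THE FINER DENOMINATOR THROUGH THE COARSE ALIASES** (fat region, `r ≤ 1∕4`):
`den (n·L) s p = U n 0 p·W1(Kof 0 0) + (Δ^{ξ∕L}(p))^s·(Σ_{k≠0} U n k p·T2_k + U n 0 p·T2far)` (`den = U_0 + (Δ^ξ)^s·Spr` one level down,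
`U_{nL}(Kof k m) = U_n(k)·W1(Kof k m)`). -/
theorem den_mul_eq {r : ℝ} (hr : r ≤ 1 / 4) (hp : p ∈ Fat d r) :
    den (n * L) s p = U n (fun _ => 0) p * W1 n L (Kof n L (fun _ => 0) (fun _ => 0)) p
      + DeltaXi (n * L) 0 p ^ s * (∑ k ∈ Finset.univ.erase (fun _ => (0 : Fin n)), U n k p * T2 n L s p k + U n (fun _ => 0) p * T2far n L s p) := by
  rw [den_eq_U_add_mul_Spr]
  have hU0 : U (n * L) (fun _ => (0 : Fin (n * L))) p = U n (fun _ => 0) p * W1 n L (Kof n L (fun _ => 0) (fun _ => 0)) p := by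
    rw [← Kof_zero n L, U_mul_Kof n L hr hp]
  rw [hU0]
  congr 1
  congr 1
  -- Spr (n·L) regrouped
  unfold Spr
  have e1 : ∑ K ∈ Finset.univ.erase (fun _ => (0 : Fin (n * L))), U (n * L) K p * ainv (n * L) s K p
      = ∑ K : Fin d → Fin (n * L), (if K = fun _ => 0 then 0 else U (n * L) K p * ainv (n * L) s K p) := by
    rw [← Finset.sum_erase_add Finset.univ _ (Finset.mem_univ (fun _ => (0 : Fin (n * L)))), if_pos rfl, add_zero]
    exact Finset.sum_congr rfl fun K hK => by rw [if_neg (Finset.ne_of_mem_erase hK)]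
  rw [e1, sum_Kof_eq n L, ← Finset.add_sum_erase Finset.univ _ (Finset.mem_univ (fun _ => (0 : Fin n)))]
  have e2 : ∑ m : Fin d → Fin L, (if Kof n L (fun _ => (0 : Fin n)) m = fun _ => 0 then 0
      else U (n * L) (Kof n L (fun _ => 0) m) p * ainv (n * L) s (Kof n L (fun _ => 0) m) p) = U n (fun _ => 0) p * T2far n L s p := by
    rw [← Finset.add_sum_erase Finset.univ _ (Finset.mem_univ (fun _ => (0 : Fin L))),
      if_pos ((Kof_zero_eq_zero_iff n L _).mpr rfl), zero_add]
    unfold T2far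
    rw [Finset.mul_sum]
    refine Finset.sum_congr rfl fun m hm => ?_
    rw [if_neg (fun h => (Finset.ne_of_mem_erase hm) ((Kof_zero_eq_zero_iff n L m).mp h)), U_mul_Kof n L hr hp]
    ring
  have e3 : ∀ k ∈ Finset.univ.erase (fun _ => (0 : Fin n)), ∑ m : Fin d → Fin L, (if Kof n L k m = fun _ => 0 then 0
      else U (n * L) (Kof n L k m) p * ainv (n * L) s (Kof n L k m) p) = U n k p * T2 n L s p k := by
    intro k hk
    unfold T2
    rw [Finset.mul_sum]
    refine Finset.sum_congr rfl fun m _ => ?_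
    rw [if_neg (Kof_ne_zero n L (Finset.ne_of_mem_erase hk) m), U_mul_Kof n L hr hp]
    ring
  rw [e2, Finset.sum_congr rfl e3, add_comm]

end Transfer

end Summit.QuantumFields.BalabanUV.Beta.FP.ConstrainedBiLaplacianResponseTwoLevel

end
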